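import Summits.SmoothPoincare4.SmoothPoincare4.Theorems.SymplecticOrigamiGromovRecognitionRelEndHelperNwtInner
import Summits.SmoothPoincare4.SmoothPoincare4.Theorems.SymplecticOrigamiGromovRecognitionRelEndHelperNwtEndgame
import Summits.SmoothPoincare4.SmoothPoincare4.Theorems.SymplecticOrigamiGromovRecognitionRelEndHelperLocalWhitney
import Summits.SmoothPoincare4.SmoothPoincare4.Theorems.SymplecticOrigamiGromovRecognitionRelEndHelperProductNbhd
import Literature.Geometry.Symplectic.ComplexOrientationExists
import Literature.Topology.FourManifolds.ConnectedSum
import Literature.Geometry.Manifold.OpenSubmanifoldMFDeriv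
import Literature.Geometry.Manifold.OpenSubmanifoldTangent
import Summits.SmoothPoincare4.SmoothPoincare4.Theorems.SymplecticOrigamiGromovRecognitionRelEndEmbeddedLocalImage
import Literature.Geometry.Symplectic.GromovCompactnessSpheresProofs

/-!
# Transfer of a trivial-normal-bundle witness along a homotopy of embedded spheres — reduction to
# an open submanifold carrying a Whitney embedding (registered helper `helper_normalWitnessTransfer`,
# line `cross-cap-laurent`, crux `GromovRecognitionRelEnd`, item stmt-SmoothPoincare4-11009; it is
# VERBATIM the birth stub `stub_normalWitnessTransfer` of the split piece `AdjunctionEmbeddedSpheres`,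
# child item stmt-SmoothPoincare4-16775, and the support item `NormalWitnessTransfer`, stmt-SmoothPoincare4-18059)

The core (a nowhere-zero normal section of the new sphere in a Whitney picture of an open submanifold,
Kirby 1989 Ch. VIII Thm. 2 in transport form) is `helper_nwtInner` (file `…HelperNwtInner.lean`); this file
reduces the statement on `X` to it: restriction to an open submanifold `U ⊇ Σ ∪ Σ₀ ∪ (homotopy)` with a
Whitney embedding proper near `Σ` (`helper_localWhitney`), the core there, the endgame `helper_nwtEndgame`
(tubular witness from the section), and push-forward of the witness to `X`.
-/

noncomputable section

open scoped Manifold ContDiff Topology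
open Set Function Metric Literature.Topology.FourManifolds Literature.Topology.FourManifolds.ComplexProjectiveSpace

set_option linter.dupNamespace false

namespace Summit.SmoothPoincare4.SmoothPoincare4.Theorems.GromovRecognitionRelEnd.CrossCapLaurent


namespace HelperNormalWitnessTransfer

variable {X : Type} [TopologicalSpace X] [ChartedSpace (EuclideanSpace ℝ (Fin 4)) X]

/-- A corestriction `g : Y → U` of `f : Y → X` to an open submanifold has at `y` every manifold
derivative that `f` has (`T_p U = T_p X`; Lee 2013, Prop. 3.9). [folklore] -/
theorem hasMFDerivAt_codRestrict {EY HY : Type*} [NormedAddCommGroup EY] [NormedSpace ℝ EY]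
    [TopologicalSpace HY] {IY : ModelWithCorners ℝ EY HY} {Y : Type*} [TopologicalSpace Y]
    [ChartedSpace HY Y] {U : TopologicalSpace.Opens X} {f : Y → X} {g : Y → U}
    (hfg : ∀ y, (g y : X) = f y) {y : Y} {f' : EY →L[ℝ] EuclideanSpace ℝ (Fin 4)}
    (hf : HasMFDerivAt IY (𝓡 4) f y f') : HasMFDerivAt IY (𝓡 4) g y f' := by
  have hw : writtenInExtChartAt IY (𝓡 4) y g = writtenInExtChartAt IY (𝓡 4) y f := by
    funext z
    simp only [writtenInExtChartAt, Function.comp_apply, extChartAt_coe,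
      TopologicalSpace.Opens.chartAt_eq, OpenPartialHomeomorph.subtypeRestr_coe, restrict_apply, hfg]
  refine ⟨?_, ?_⟩
  · rw [Topology.IsInducing.subtypeVal.continuousAt_iff]
    exact hf.1.congr_of_eventuallyEq (Filter.Eventually.of_forall hfg)
  · have heq : writtenInExtChartAt IY (𝓡 4) y g =ᶠ[𝓝 ((extChartAt IY y) y)]
        writtenInExtChartAt IY (𝓡 4) y f := Filter.Eventually.of_forall fun z => congrFun hw z
    exact hf.2.congr_of_eventuallyEq (heq.filter_mono nhdsWithin_le_nhds) heq.eq_of_nhds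

/-- Smoothness of a corestriction to an open submanifold. [folklore] -/
theorem contMDiff_codRestrict {EY HY : Type*} [NormedAddCommGroup EY] [NormedSpace ℝ EY]
    [TopologicalSpace HY] {IY : ModelWithCorners ℝ EY HY} {Y : Type*} [TopologicalSpace Y]
    [ChartedSpace HY Y] {U : TopologicalSpace.Opens X} {f : Y → X} {g : Y → U}
    (hfg : ∀ y, (g y : X) = f y) (hf : ContMDiff IY (𝓡 4) ∞ f) : ContMDiff IY (𝓡 4) ∞ g := by
  have : (Subtype.val ∘ g) = f := funext hfg
  exact (ContMDiff.subtypeVal_comp_iff U g).1 (this ▸ hf)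


/-- A function on `X` whose composite with the inclusion of an open submanifold `U` is `C^n` at
`q : U` is `C^n` at `↑q` (the charts of `U` are the restricted charts of `X`; Lee 2013, Ex. 1.26).
[folklore] -/
theorem contMDiffAt_of_comp_subtypeVal {E' : Type*} [NormedAddCommGroup E'] [NormedSpace ℝ E']
    {U : TopologicalSpace.Opens X} {f : X → E'} {q : U} {n : ℕ∞ω}
    (h : ContMDiffAt (𝓡 4) 𝓘(ℝ, E') n (f ∘ Subtype.val) q) : ContMDiffAt (𝓡 4) 𝓘(ℝ, E') n f (q : X) := by
  rw [contMDiffAt_iff] at h ⊢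
  refine ⟨(U.2.isOpenEmbedding_subtypeVal.continuousAt_iff).1 h.1, ?_⟩
  have h2 := h.2
  have hpt : extChartAt (𝓡 4) q q = extChartAt (𝓡 4) (q : X) q := rfl
  rw [hpt] at h2
  refine h2.congr_of_eventuallyEq_of_mem ?_ ?_
  · have ht : (extChartAt (𝓡 4) q).target ∈ 𝓝[range (𝓡 4)] (extChartAt (𝓡 4) (q : X) q) := by
      rw [← hpt]; exact extChartAt_target_mem_nhdsWithin q
    filter_upwards [ht] with p hp
    simp only [Function.comp_apply, extChartAt_model_space_eq_id, PartialEquiv.refl_coe, id_eq]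
    rw [Literature.Geometry.Manifold.OpenSubmanifold.val_extChartAt_symm hp]
  · exact mem_range_self _

end HelperNormalWitnessTransfer

open HelperNormalWitnessTransfer HelperProductNbhd Literature.Geometry.Symplectic in
/-- **Transfer of a trivial-normal-bundle witness along a homotopy of embedded spheres** (the
differential-topology half C2 of the adjunction apex; Gompf–Stipsicz 1999 §1.2, Kirby 1989 Ch. VIII
Thm. 2): reduction to the open submanifold `U ⊇` (both spheres and the homotopy) carrying a local
Whitney embedding proper near the sphere (`helper_localWhitney`), the core `helper_nwtInner` there, the
endgame `helper_nwtEndgame`, and push-forward of the witness to `X`. [cite: Kirby1989, Ch. VIII, Thm. 2] -/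
theorem helper_normalWitnessTransfer : ∀ (X : Type) [TopologicalSpace X] [T2Space X] [SecondCountableTopology X] [ChartedSpace (EuclideanSpace ℝ (Fin 4)) X] [IsManifold (𝓡 4) ∞ X] (_JX : Literature.Geometry.Symplectic.AlmostComplexStructure (𝓡 4) ∞ X) (u₀ v₀ : ℂ → X) (N : Set X) (π : X → ℂ) (u v : ℂ → X) (F F₀ : C(Literature.Topology.FourManifolds.ComplexProjectiveSpace 1, X)), ContMDiff 𝓘(ℝ, ℂ) (𝓡 4) ∞ u₀ → ContMDiff 𝓘(ℝ, ℂ) (𝓡 4) ∞ v₀ → (∀ z : ℂ, z ≠ 0 → v₀ z = u₀ z⁻¹) → Function.Injective u₀ → (∀ z, Function.Injective (mfderiv 𝓘(ℝ, ℂ) (𝓡 4) u₀ z)) → Function.Injective (mfderiv 𝓘(ℝ, ℂ) (𝓡 4) v₀ 0) → v₀ 0 ∉ Set.range u₀ → IsOpen N → Set.range u₀ ∪ {v₀ 0} ⊆ N → ContMDiffOn (𝓡 4) 𝓘(ℝ, ℂ) ∞ π N → (∀ y ∈ N, Function.Surjective (mfderiv (𝓡 4) 𝓘(ℝ, ℂ)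 π y)) → {y | y ∈ N ∧ π y = 0} = Set.range u₀ ∪ {v₀ 0} → ContMDiff 𝓘(ℝ, ℂ) (𝓡 4) ∞ u → ContMDiff 𝓘(ℝ, ℂ) (𝓡 4) ∞ v → (∀ z : ℂ, z ≠ 0 → v z = u z⁻¹) → Function.Injective u → (∀ z, Function.Injective (mfderiv 𝓘(ℝ, ℂ) (𝓡 4) u z)) → Function.Injective (mfderiv 𝓘(ℝ, ℂ) (𝓡 4) v 0) → v 0 ∉ Set.range u → (∀ p, Literature.Topology.FourManifolds.ComplexProjectiveSpace.CoordNeZero 0 p → F p = u (Literature.Topology.FourManifolds.ComplexProjectiveSpace.affineCoordComplex 0 p 0)) → (∀ p, Literature.Topology.FourManifolds.ComplexProjectiveSpace.CoordNeZero 1 p → F p = v (Literature.Topology.FourManifolds.ComplexProjectiveSpace.affineCoordComplex 1 p 0)) → (∀ p, Literature.Topology.FourManifolds.ComplexProjectiveSpace.CoordNeZero 0 p → F₀ p = u₀ (Literature.Topology.FourManifolds.ComplexProjectiveSpace.affineCoordComplex 0 p 0)) → (∀ p, Literature.Topology.FourManifolds.ComplexProjectiveSpace.CoordNeZero 1 p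 → F₀ p = v₀ (Literature.Topology.FourManifolds.ComplexProjectiveSpace.affineCoordComplex 1 p 0)) → F.Homotopic F₀ → ∃ (N' : Set X) (π' : X → ℂ), IsOpen N' ∧ Set.range u ∪ {v 0} ⊆ N' ∧ ContMDiffOn (𝓡 4) 𝓘(ℝ, ℂ) ∞ π' N' ∧ (∀ y ∈ N', Function.Surjective (mfderiv (𝓡 4) 𝓘(ℝ, ℂ) π' y)) ∧ {y | y ∈ N' ∧ π' y = 0} = Set.range u ∪ {v 0} := by
  intro X _ _ _ _ _ JX u₀ v₀ N π u v F F₀ hu₀ hv₀ hc₀ hinj₀ himm₀ himmv₀ hinf₀ hNo hSN hπ hπs hzero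
    hu hv hc hinj himm himmv hinf hF0 hF1 hF₀0 hF₀1 hhom
  classical
  -- orientation of `X` from the almost complex structure
  haveI : LocallyCompactSpace X := ChartedSpace.locallyCompactSpace (EuclideanSpace ℝ (Fin 4)) X
  haveI : SigmaCompactSpace X := sigmaCompactSpace_of_locallyCompact_secondCountable
  obtain ⟨oX⟩ := JX.isOrientable
  -- ranges of the glued maps; the homotopy; the compact set `K`
  have hrF : range F = range u ∪ {v 0} := helper_gluedRange X u v F hc hF0 hF1
  have hrF₀ : range F₀ = range u₀ ∪ {v₀ 0} := helper_gluedRange X u₀ v₀ F₀ hc₀ hF₀0 hF₀1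
  obtain ⟨H⟩ := hhom
  set K : Set X := (range F ∪ range F₀) ∪ range H with hK
  have hKc : IsCompact K :=
    ((isCompact_range F.continuous).union (isCompact_range F₀.continuous)).union
      (isCompact_range H.continuous)
  obtain ⟨U, K₁, m, e, η, hUo, hK₁c, hKU, hK₁U, hη, he, heinj, hde, hprop⟩ :=
    helper_localWhitney X K hKc
  -- memberships in `U`
  have hFU : ∀ θ, F θ ∈ U := fun θ => hKU (Or.inl (Or.inl ⟨θ, rfl⟩))
  have hF₀U : ∀ θ, F₀ θ ∈ U := fun θ => hKU (Or.inl (Or.inr ⟨θ, rfl⟩))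
  have hHU : ∀ q, H q ∈ U := fun q => hKU (Or.inr ⟨q, rfl⟩)
  have hSU : range u ∪ {v 0} ⊆ U := fun y hy => by
    rw [← hrF] at hy; obtain ⟨θ, rfl⟩ := hy; exact hFU θ
  have hS₀U : range u₀ ∪ {v₀ 0} ⊆ U := fun y hy => by
    rw [← hrF₀] at hy; obtain ⟨θ, rfl⟩ := hy; exact hF₀U θ
  have huU : ∀ z, u z ∈ U := fun z => hSU (Or.inl ⟨z, rfl⟩)
  have hvU : ∀ z, v z ∈ U := fun z => by
    by_cases hz : z = 0
    · rw [hz]; exact hSU (Or.inr rfl)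
    · rw [hc z hz]; exact huU _
  have hu₀U : ∀ z, u₀ z ∈ U := fun z => hS₀U (Or.inl ⟨z, rfl⟩)
  have hv₀U : ∀ z, v₀ z ∈ U := fun z => by
    by_cases hz : z = 0
    · rw [hz]; exact hS₀U (Or.inr rfl)
    · rw [hc₀ z hz]; exact hu₀U _
  -- the open submanifold and the corestricted data
  let U' : TopologicalSpace.Opens X := ⟨U, hUo⟩
  let u' : ℂ → U' := fun z => ⟨u z, huU z⟩
  let v' : ℂ → U' := fun z => ⟨v z, hvU z⟩
  let u₀' : ℂ → U' := fun z => ⟨u₀ z, hu₀U z⟩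
  let v₀' : ℂ → U' := fun z => ⟨v₀ z, hv₀U z⟩
  let F' : C(ComplexProjectiveSpace 1, U') := ⟨fun θ => ⟨F θ, hFU θ⟩, F.continuous.subtype_mk _⟩
  let F₀' : C(ComplexProjectiveSpace 1, U') := ⟨fun θ => ⟨F₀ θ, hF₀U θ⟩, F₀.continuous.subtype_mk _⟩
  let N' : Set U' := Subtype.val ⁻¹' N
  let π' : U' → ℂ := fun y => π y
  -- smoothness and derivatives transfer to the corestrictions
  have hu' : ContMDiff 𝓘(ℝ, ℂ) (𝓡 4) ∞ u' := contMDiff_codRestrict (fun _ => rfl) hu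
  have hv' : ContMDiff 𝓘(ℝ, ℂ) (𝓡 4) ∞ v' := contMDiff_codRestrict (fun _ => rfl) hv
  have hu₀' : ContMDiff 𝓘(ℝ, ℂ) (𝓡 4) ∞ u₀' := contMDiff_codRestrict (fun _ => rfl) hu₀
  have hv₀' : ContMDiff 𝓘(ℝ, ℂ) (𝓡 4) ∞ v₀' := contMDiff_codRestrict (fun _ => rfl) hv₀
  have hmf : ∀ {w : ℂ → X} {w' : ℂ → U'} (_ : ∀ z, (w' z : X) = w z) (_ : ContMDiff 𝓘(ℝ, ℂ) (𝓡 4) ∞ w)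
      (z : ℂ), mfderiv 𝓘(ℝ, ℂ) (𝓡 4) w' z = mfderiv 𝓘(ℝ, ℂ) (𝓡 4) w z := by
    intro w w' hww hw z
    exact (hasMFDerivAt_codRestrict hww ((hw.mdifferentiableAt (by simp)).hasMFDerivAt (x := z))).mfderiv
  -- `F` is a smooth injective immersion, and so is its corestriction `F'`
  set uv : Fin 2 → ℂ → X := ![u, v] with huvdef
  have huv : ∀ i, ContMDiff 𝓘(ℝ, ℂ) (𝓡 4) ∞ (uv i) := Fin.forall_fin_two.2 ⟨hu, hv⟩
  have hFuv : ∀ i p, CoordNeZero i p → F p = uv i (affineCoordComplex i p 0) :=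
    Fin.forall_fin_two.2 ⟨hF0, hF1⟩
  have hduv : ∀ i z, Injective (mfderiv 𝓘(ℝ, ℂ) (𝓡 4) (uv i) z) :=
    Fin.forall_fin_two.2 ⟨himm, injective_mfderiv_infty hu hc himm himmv⟩
  have hFs : ContMDiff (𝓡 2) (𝓡 4) ∞ F := contMDiff_glued huv hFuv
  have hFd : ∀ x, Injective (mfderiv (𝓡 2) (𝓡 4) F x) := fun x => by
    have h' : mfderiv (𝓡 2) (𝓡 4) F x = _ :=
      (hasMFDerivAt_glued x (hFuv (chartIndex x)) (((huv _) _).mdifferentiableAt (by simp))).mfderiv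
    rw [h']
    exact (hduv _ _).comp injective_lam
  have hFinj : Injective F := EmbeddedLocalImage.locImg_glued_injective hF0 hF1 hinj hinf
  have hF's : ContMDiff (𝓡 2) (𝓡 4) ∞ F' := contMDiff_codRestrict (fun _ => rfl) hFs
  have hF'inj : Injective F' := fun a b h => hFinj (congrArg Subtype.val h)
  have hF'd : ∀ x, Injective (mfderiv (𝓡 2) (𝓡 4) F' x) := by
    intro x
    rw [(hasMFDerivAt_codRestrict (f := F) (g := F') (fun _ => rfl)
      ((hFs.mdifferentiableAt (by simp)).hasMFDerivAt (x := x))).mfderiv]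
    exact hFd x
  -- the Whitney datum on `U'`
  have he' : ContMDiff (𝓡 4) 𝓘(ℝ, EuclideanSpace ℝ (Fin m)) ∞ (fun y : U' => e y) :=
    he.comp contMDiff_subtype_val
  have he'inj : Injective (fun y : U' => e y) := fun a b h => Subtype.ext (heinj a.2 b.2 h)
  have hde' : ∀ y : U', Injective (mfderiv (𝓡 4) 𝓘(ℝ, EuclideanSpace ℝ (Fin m)) (fun y : U' => e y) y) := by
    intro y
    have h1 : HasMFDerivAt (𝓡 4) (𝓡 4) (Subtype.val : U' → X) y (ContinuousLinearMap.id ℝ _) :=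
      Literature.Geometry.Manifold.OpenSubmanifold.hasMFDerivAt_subtype_val y
    have h2 : HasMFDerivAt (𝓡 4) 𝓘(ℝ, EuclideanSpace ℝ (Fin m)) (fun y : U' => e y) y
        ((mfderiv (𝓡 4) 𝓘(ℝ, EuclideanSpace ℝ (Fin m)) e y.1).comp (ContinuousLinearMap.id ℝ _)) :=
      ((he y.1).mdifferentiableAt (by simp)).hasMFDerivAt.comp y h1
    rw [h2.mfderiv]
    intro a b hab
    exact hde y.1 y.2 hab
  let D : CodimTwoData 2 U' (ComplexProjectiveSpace 1) (EuclideanSpace ℝ (Fin m)) :=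
    { e := fun y => e y, b := F', he := he', heinj := he'inj, hde := hde', hb := hF's,
      hbinj := hF'inj, hdb := hF'd }
  -- properness of the embedding near the sphere
  have hprop' : IsCompact {q : U' | infDist (D.e q) D.img ≤ η / 2} := by
    have hsub : {q : U' | infDist (D.e q) D.img ≤ η / 2} ⊆ Subtype.val ⁻¹' K₁ := by
      intro q hq
      obtain ⟨θ₀⟩ : Nonempty (ComplexProjectiveSpace 1) := inferInstance
      have hne : (D.img).Nonempty := ⟨D.f θ₀, ⟨θ₀, rfl⟩⟩
      have hq' : infDist (D.e q) D.img < η := lt_of_le_of_lt hq (half_lt_self hη)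
      obtain ⟨_, ⟨θ, rfl⟩, hlt⟩ := (Metric.infDist_lt_iff hne).1 hq'
      exact hprop q.1 q.2 (F θ) (Or.inl (Or.inl ⟨θ, rfl⟩)) hlt
    have hcl : IsClosed {q : U' | infDist (D.e q) D.img ≤ η / 2} :=
      isClosed_le ((continuous_infDist_pt _).comp D.he.continuous) continuous_const
    have hK₁' : IsCompact (Subtype.val ⁻¹' K₁ : Set U') := by
      refine (Topology.IsEmbedding.subtypeVal.isCompact_iff).2 ?_
      rw [Set.image_preimage_eq_of_subset]
      · exact hK₁c
      · intro x hx
        exact ⟨⟨x, hK₁U hx⟩, rfl⟩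
    exact hK₁'.of_isClosed_subset hcl hsub
  -- the hypotheses on `U'`
  have hc' : ∀ z : ℂ, z ≠ 0 → v' z = u' z⁻¹ := fun z hz => Subtype.ext (hc z hz)
  have hc₀' : ∀ z : ℂ, z ≠ 0 → v₀' z = u₀' z⁻¹ := fun z hz => Subtype.ext (hc₀ z hz)
  have hinj' : Injective u' := fun a b h => hinj (congrArg Subtype.val h)
  have hinj₀' : Injective u₀' := fun a b h => hinj₀ (congrArg Subtype.val h)
  have himm' : ∀ z, Injective (mfderiv 𝓘(ℝ, ℂ) (𝓡 4) u' z) := fun z => by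
    rw [hmf (fun _ => rfl) hu z]; exact himm z
  have himm₀' : ∀ z, Injective (mfderiv 𝓘(ℝ, ℂ) (𝓡 4) u₀' z) := fun z => by
    rw [hmf (fun _ => rfl) hu₀ z]; exact himm₀ z
  have himmv' : Injective (mfderiv 𝓘(ℝ, ℂ) (𝓡 4) v' 0) := by
    rw [hmf (fun _ => rfl) hv 0]; exact himmv
  have himmv₀' : Injective (mfderiv 𝓘(ℝ, ℂ) (𝓡 4) v₀' 0) := by
    rw [hmf (fun _ => rfl) hv₀ 0]; exact himmv₀
  have hinf' : v' 0 ∉ range u' := by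
    rintro ⟨z, hz⟩; exact hinf ⟨z, congrArg Subtype.val hz⟩
  have hinf₀' : v₀' 0 ∉ range u₀' := by
    rintro ⟨z, hz⟩; exact hinf₀ ⟨z, congrArg Subtype.val hz⟩
  have hF0' : ∀ p, CoordNeZero 0 p → F' p = u' (affineCoordComplex 0 p 0) := fun p hp => Subtype.ext (hF0 p hp)
  have hF1' : ∀ p, CoordNeZero 1 p → F' p = v' (affineCoordComplex 1 p 0) := fun p hp => Subtype.ext (hF1 p hp)
  have hF₀0' : ∀ p, CoordNeZero 0 p → F₀' p = u₀' (affineCoordComplex 0 p 0) := fun p hp => Subtype.ext (hF₀0 p hp)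
  have hF₀1' : ∀ p, CoordNeZero 1 p → F₀' p = v₀' (affineCoordComplex 1 p 0) := fun p hp => Subtype.ext (hF₀1 p hp)
  have hN'o : IsOpen N' := hNo.preimage continuous_subtype_val
  have hSN' : range u₀' ∪ {v₀' 0} ⊆ N' := by
    rintro y (⟨z, rfl⟩ | hy)
    · exact hSN (Or.inl ⟨z, rfl⟩)
    · rw [mem_singleton_iff] at hy; rw [hy]; exact hSN (Or.inr rfl)
  have hπ' : ContMDiffOn (𝓡 4) 𝓘(ℝ, ℂ) ∞ π' N' :=
    hπ.comp contMDiff_subtype_val.contMDiffOn fun y hy => hy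
  have hπ's : ∀ y ∈ N', Surjective (mfderiv (𝓡 4) 𝓘(ℝ, ℂ) π' y) := by
    intro y hy
    have h1 : HasMFDerivAt (𝓡 4) (𝓡 4) (Subtype.val : U' → X) y (ContinuousLinearMap.id ℝ _) :=
      Literature.Geometry.Manifold.OpenSubmanifold.hasMFDerivAt_subtype_val y
    have h2 : HasMFDerivAt (𝓡 4) 𝓘(ℝ, ℂ) π' y
        ((mfderiv (𝓡 4) 𝓘(ℝ, ℂ) π y.1).comp (ContinuousLinearMap.id ℝ _)) :=
      ((hπ.contMDiffAt (hNo.mem_nhds hy)).mdifferentiableAt (by simp)).hasMFDerivAt.comp y h1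
    rw [h2.mfderiv]
    intro c; obtain ⟨a, ha⟩ := hπs y.1 hy c; exact ⟨a, ha⟩
  have hzero' : {y | y ∈ N' ∧ π' y = 0} = range u₀' ∪ {v₀' 0} := by
    ext y
    have hy : (y ∈ N' ∧ π' y = 0) ↔ (y : X) ∈ {y | y ∈ N ∧ π y = 0} := Iff.rfl
    simp only [mem_setOf_eq]
    rw [hy, hzero]
    constructor
    · rintro (⟨z, hz⟩ | h0)
      · exact Or.inl ⟨z, Subtype.ext hz⟩
      · exact Or.inr (Subtype.ext h0)
    · rintro (⟨z, hz⟩ | h0)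
      · exact Or.inl ⟨z, congrArg Subtype.val hz⟩
      · rw [mem_singleton_iff] at h0
        exact Or.inr (congrArg Subtype.val h0)
  have hhom' : F'.Homotopic F₀' :=
    ⟨{ toFun := fun q => ⟨H q, hHU q⟩
       continuous_toFun := H.continuous.subtype_mk _
       map_zero_left := fun x => Subtype.ext (H.map_zero_left x)
       map_one_left := fun x => Subtype.ext (H.map_one_left x) }⟩
  -- the core and the endgame on `U'`
  obtain ⟨s₀, hs₀c, hs₀⟩ := helper_nwtInner m U' (oX.restrict U') D (η / 2) u' v' u₀' v₀' N' π' F' F₀'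
    (half_pos hη) hprop' (fun _ => rfl) hu' hv' hc' hinj' himm' himmv' hinf' hF0' hF1' hu₀' hv₀' hc₀'
    hinj₀' himm₀' himmv₀' hinf₀' hN'o hSN' hπ' hπ's hzero' hF₀0' hF₀1' hhom'
  obtain ⟨N'', π'', hN''o, hbN'', hπ''s, hπ''d, hzero''⟩ := helper_nwtEndgame m U' D s₀ hs₀c hs₀
  -- push the witness forward to `X`
  let π₃ : X → ℂ := fun y => if h : y ∈ U then π'' ⟨y, h⟩ else 0
  have hπ₃ : ∀ q : U', π₃ q = π'' q := fun q => by
    show (if h : (q : X) ∈ U then π'' ⟨q, h⟩ else 0) = π'' q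
    have hq : (q : X) ∈ U := q.2
    simp only [hq, dite_true]
  have hrange : range D.b = range F' := rfl
  refine ⟨Subtype.val '' N'', π₃, hUo.isOpenMap_subtype_val _ hN''o, ?_, ?_, ?_, ?_⟩
  · intro y hy
    rw [← hrF] at hy
    obtain ⟨θ, rfl⟩ := hy
    exact ⟨F' θ, hbN'' ⟨θ, rfl⟩, rfl⟩
  · rintro _ ⟨q, hq, rfl⟩
    have h1 : ContMDiffAt (𝓡 4) 𝓘(ℝ, ℂ) ∞ π'' q := hπ''s.contMDiffAt (hN''o.mem_nhds hq)
    have h2 : ContMDiffAt (𝓡 4) 𝓘(ℝ, ℂ) ∞ (π₃ ∘ Subtype.val) q :=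
      h1.congr_of_eventuallyEq (Filter.Eventually.of_forall fun q' => hπ₃ q')
    exact (contMDiffAt_of_comp_subtypeVal h2).contMDiffWithinAt
  · rintro _ ⟨q, hq, rfl⟩
    have h1 : ContMDiffAt (𝓡 4) 𝓘(ℝ, ℂ) ∞ π'' q := hπ''s.contMDiffAt (hN''o.mem_nhds hq)
    have h2 : ContMDiffAt (𝓡 4) 𝓘(ℝ, ℂ) ∞ (π₃ ∘ Subtype.val) q :=
      h1.congr_of_eventuallyEq (Filter.Eventually.of_forall fun q' => hπ₃ q')
    have h3 : MDifferentiableAt (𝓡 4) 𝓘(ℝ, ℂ) π₃ (q : X) :=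
      (contMDiffAt_of_comp_subtypeVal h2).mdifferentiableAt (by simp)
    have h4 : HasMFDerivAt (𝓡 4) (𝓡 4) (Subtype.val : U' → X) q (ContinuousLinearMap.id ℝ _) :=
      Literature.Geometry.Manifold.OpenSubmanifold.hasMFDerivAt_subtype_val q
    have h5 : HasMFDerivAt (𝓡 4) 𝓘(ℝ, ℂ) (π₃ ∘ Subtype.val) q
        ((mfderiv (𝓡 4) 𝓘(ℝ, ℂ) π₃ q).comp (ContinuousLinearMap.id ℝ _)) :=
      h3.hasMFDerivAt.comp q h4
    have h6 : HasMFDerivAt (𝓡 4) 𝓘(ℝ, ℂ) π'' q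
        ((mfderiv (𝓡 4) 𝓘(ℝ, ℂ) π₃ q).comp (ContinuousLinearMap.id ℝ _)) :=
      h5.congr_of_eventuallyEq (Filter.Eventually.of_forall fun q' => (hπ₃ q').symm)
    have h7 := hπ''d q hq
    rw [h6.mfderiv] at h7
    intro c; obtain ⟨a, ha⟩ := h7 c; exact ⟨a, ha⟩
  · ext y
    simp only [mem_setOf_eq, mem_image]
    constructor
    · rintro ⟨⟨q, hq, rfl⟩, h0⟩
      have : q ∈ {y | y ∈ N'' ∧ π'' y = 0} := ⟨hq, by rw [← hπ₃ q]; exact h0⟩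
      rw [hzero'', hrange] at this
      obtain ⟨θ, hθ⟩ := this
      rw [← hrF]
      exact ⟨θ, congrArg Subtype.val hθ⟩
    · intro hy
      rw [← hrF] at hy
      obtain ⟨θ, rfl⟩ := hy
      have hmem : F' θ ∈ {y | y ∈ N'' ∧ π'' y = 0} := by
        rw [hzero'', hrange]; exact ⟨θ, rfl⟩
      exact ⟨⟨F' θ, hmem.1, rfl⟩, by rw [show (F θ : X) = (F' θ : X) from rfl, hπ₃]; exact hmem.2⟩

end Summit.SmoothPoincare4.SmoothPoincare4.Theorems.GromovRecognitionRelEnd.CrossCapLaurent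

end
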